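import Literature.Computability.QuantumComplexity.HadamardGadgetPostLenFP
import Literature.Computability.Complexity.FoldBricks
import HarnessLib

/-!
# The Hadamard gadget, VII: string bricks for the description of the padded gadget family

Topic `Literature/Computability/QuantumComplexity`; sequel of `HadamardGadgetPostLenFP.lean`
(Bremner–Jozsa–Shepherd 2011, proof of Thm. 1; uniformity half). Bricks of the `FP` string
algebra of `Complexity/` out of which the closed-form description `HGadget.gadgetDesc` is computed
in the sequel files:

* numerals: `canonN` (canonical numeral of a value), `succN`; the relabelling on numerals
  `rhoF ⟨⟨bin n, bin T⟩, v⟩ = bin (rho n T ⟦v⟧)` (`rhoF_apply`);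
* op codes: `czBlockF ⟨⟨bin n, bin T⟩, ⟨v, w⟩⟩ = ⟨opCode (CZ (ρ ⟦v⟧) (ρ ⟦w⟧)), ε⟩`, `tBlockF`,
  `zBlockF` — one item of the pair list `encList` of gate codes (`boolPair_eq_append`:
  `encList (c :: l) = ⟨c, ε⟩ ++ encList l`);
* **the `CZ` layer loop** `layerF`: on a context `⟨y, ⟨⟨bin n, bin T⟩, ⟨bin N, ⟨bin A, ⟨bin B, ⟨bin t, bin s⟩⟩⟩⟩⟩⟩`
  (`y` a yardstick of length `≥ N` and `≥` every numeral involved) it emits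
  `encList [opCode (CZ (ρ (src a)) (ρ (B + a))) | a < N]` with `src a = s` if `a = t` and `A + a`
  otherwise (`layerF_apply`) — the shape of all four layers of `gadgetCodes` (`initOps`, the two
  layers of a slot, `lastOps`); a counted fold (`Brick.foldLoop appF`) of a clipped piece function.

Everything is a total string function with membership in `FP`, a value on well-formed records and
a length bound on every input (the currency of the growth lemmas of `Brick.foldFn`/`foldLoop`).

## References

* S. Arora, B. Barak, *Computational Complexity: A Modern Approach*, CUP 2009, §1.3 (closure of
  polynomial time under composition and bounded loops), §6.2, Remark 6.7.
* M. J. Bremner, R. Jozsa, D. J. Shepherd, Proc. R. Soc. A 467 (2011), Thm. 1 (proof), p. 7.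
-/

noncomputable section

namespace Literature.Computability.QuantumComplexity

open _root_.Computability Complexity Cryptography Brick Polynomial

namespace HGadget

/-! ### Pair lists -/

/-- A pair is its first block followed by the second component. [folklore] -/
theorem boolPair_eq_append (a b : List Bool) : boolPair a b = boolPair a [] ++ b := by
  simp [boolPair]

/-- `encList` of a cons as a concatenation. [folklore] -/
theorem encList_cons_eq_append (a : List Bool) (l : List (List Bool)) :
    encList (a :: l) = boolPair a [] ++ encList l := by
  rw [encList_cons, boolPair_eq_append]

/-- `encList` of a concatenation. [folklore] -/
theorem encList_append' (l l' : List (List Bool)) : encList (l ++ l') = encList l ++ encList l' := by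
  induction l with
  | nil => simp
  | cons a l ih => rw [List.cons_append, encList_cons_eq_append, encList_cons_eq_append, ih, List.append_assoc]

/-- `encList` of an `ofFn` as a concatenation of blocks. [folklore] -/
theorem encList_ofFn_eq_ccat {N : ℕ} (c : Fin N → List Bool) (c' : ℕ → List Bool)
    (hc : ∀ a : Fin N, c a = c' a) :
    encList (List.ofFn c) = ccat (fun j => boolPair (c' j) []) N := by
  induction N with
  | zero => simp
  | succ N ih =>
    rw [List.ofFn_succ', List.concat_eq_append, encList_append', ccat_succ,
      ih (fun i => c (Fin.castSucc i)) (fun a => hc _)]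
    simp [encList_cons, hc]

/-! ### Numerals -/

/-- `[decide p] = [true] ↔ p`, the reading of one-bit conditions. [folklore] -/
theorem singleton_decide_eq_iff (p : Prop) [Decidable p] : ([decide p] = [true]) ↔ p := by
  by_cases h : p <;> simp [h]

/-- The canonical numeral of the value of a string. [folklore] -/
def canonN : List Bool → List Bool := addFn ∘ fanoutFn id fun _ => []

/-- Value of `canonN`. [folklore] -/
@[simp] theorem canonN_apply (v : List Bool) : canonN v = encodeNat (bitsToNat v) := by
  simp [canonN]

/-- `canonN ∈ FP`. [folklore] -/
theorem canonN_mem_FP : canonN ∈ FP :=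
  comp_mem_FP addFn_mem_FP (fanoutFn_mem_FP (PolyTimeComputable.id _) (const_mem_FP _))

/-- `canonN` does not lengthen. [folklore] -/
theorem length_canonN_le (v : List Bool) : (canonN v).length ≤ v.length := by
  rw [canonN_apply]; exact length_encodeNat_bitsToNat_le v

/-- The successor numeral. [folklore] -/
def succN : List Bool → List Bool := addFn ∘ fanoutFn id fun _ => encodeNat 1

/-- Value of `succN`. [folklore] -/
@[simp] theorem succN_apply (v : List Bool) : succN v = encodeNat (bitsToNat v + 1) := by
  simp [succN]

/-- `succN ∈ FP`. [folklore] -/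
theorem succN_mem_FP : succN ∈ FP :=
  comp_mem_FP addFn_mem_FP (fanoutFn_mem_FP (PolyTimeComputable.id _) (const_mem_FP _))

/-- `|bin 1| = 1`. [folklore] -/
theorem length_encodeNat_one : (encodeNat 1).length = 1 := by decide

/-- `succN` lengthens by at most two. [folklore] -/
theorem length_succN_le (v : List Bool) : (succN v).length ≤ v.length + 2 := by
  rw [succN_apply]
  have h := length_encodeNat_add_le v (encodeNat 1)
  rw [bitsToNat_encodeNat, length_encodeNat_one] at h
  omega

/-- `|bin (a + b)| ≤ |bin a| + |bin b| + 1`. [folklore] -/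
theorem length_encodeNat_add_le' (a b : ℕ) : (encodeNat (a + b)).length ≤ (encodeNat a).length + (encodeNat b).length + 1 := by
  have h := length_encodeNat_add_le (encodeNat a) (encodeNat b)
  rwa [bitsToNat_encodeNat, bitsToNat_encodeNat] at h

/-- `|bin a| ≤ a`. [folklore] -/
theorem length_encodeNat_le_self (a : ℕ) : (encodeNat a).length ≤ a := by
  rw [TM2Pass.length_encodeNat_eq_size]; exact Nat.size_le.2 Nat.lt_two_pow_self

/-! ### The relabelling on numerals -/

/-- **`rho` on numerals**: on `⟨⟨bin n, bin T⟩, v⟩`, the canonical numeral of `rho n T ⟦v⟧`.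
[cite: BremnerJozsaShepherdPRSA2011, Thm. 1 (proof)] -/
def rhoF : List Bool → List Bool :=
  iteFn (ltFn ∘ fanoutFn sndF (fstF ∘ fstF)) (canonN ∘ sndF)
    (iteFn (ltFn ∘ fanoutFn sndF (sndF ∘ fstF)) (succN ∘ sndF)
      (iteFn (eqValFn ∘ fanoutFn sndF (sndF ∘ fstF)) (canonN ∘ fstF ∘ fstF) (canonN ∘ sndF)))

/-- `rhoF ∈ FP`. [folklore] -/
theorem rhoF_mem_FP : rhoF ∈ FP :=
  iteFn_mem_FP (comp_mem_FP ltFn_mem_FP (fanoutFn_mem_FP sndF_mem_FP (comp_mem_FP fstF_mem_FP fstF_mem_FP)))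
    (comp_mem_FP canonN_mem_FP sndF_mem_FP)
    (iteFn_mem_FP (comp_mem_FP ltFn_mem_FP (fanoutFn_mem_FP sndF_mem_FP (comp_mem_FP sndF_mem_FP fstF_mem_FP)))
      (comp_mem_FP succN_mem_FP sndF_mem_FP)
      (iteFn_mem_FP (comp_mem_FP eqValFn_mem_FP (fanoutFn_mem_FP sndF_mem_FP (comp_mem_FP sndF_mem_FP fstF_mem_FP)))
        (comp_mem_FP canonN_mem_FP (comp_mem_FP fstF_mem_FP fstF_mem_FP))
        (comp_mem_FP canonN_mem_FP sndF_mem_FP)))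

/-- **Value of `rhoF`.** (The record is kept opaque while branching, so that no decision
procedure is unfolded on it.) [folklore] -/
theorem rhoF_apply (n T : ℕ) (v : List Bool) :
    rhoF (boolPair (boolPair (encodeNat n) (encodeNat T)) v) = encodeNat (rho n T (bitsToNat v)) := by
  set z := boolPair (boolPair (encodeNat n) (encodeNat T)) v with hz
  have c1 : (ltFn ∘ fanoutFn sndF (fstF ∘ fstF)) z = [decide (bitsToNat v < n)] := by
    simp only [hz, Function.comp_apply, fanoutFn_apply, sndF_boolPair, fstF_boolPair, ltFn_boolPair,
      bitsToNat_encodeNat]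
  have c2 : (ltFn ∘ fanoutFn sndF (sndF ∘ fstF)) z = [decide (bitsToNat v < T)] := by
    simp only [hz, Function.comp_apply, fanoutFn_apply, sndF_boolPair, fstF_boolPair, ltFn_boolPair,
      bitsToNat_encodeNat]
  have c3 : (eqValFn ∘ fanoutFn sndF (sndF ∘ fstF)) z = [decide (bitsToNat v = T)] := by
    simp only [hz, Function.comp_apply, fanoutFn_apply, sndF_boolPair, fstF_boolPair, eqValFn_boolPair,
      bitsToNat_encodeNat]
  have b1 : (canonN ∘ sndF) z = encodeNat (bitsToNat v) := by
    simp only [hz, Function.comp_apply, sndF_boolPair, canonN_apply]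
  have b2 : (succN ∘ sndF) z = encodeNat (bitsToNat v + 1) := by
    simp only [hz, Function.comp_apply, sndF_boolPair, succN_apply]
  have b3 : (canonN ∘ fstF ∘ fstF) z = encodeNat n := by
    simp only [hz, Function.comp_apply, fstF_boolPair, canonN_apply, bitsToNat_encodeNat]
  unfold rho
  rw [rhoF, iteFn_of_oneBit (oneBit_ltFn.comp _)]
  by_cases h1 : bitsToNat v < n
  · rw [if_pos (by rw [c1]; simp [h1]), if_pos h1, b1]
  · rw [if_neg (by rw [c1]; simp [h1]), if_neg h1, iteFn_of_oneBit (oneBit_ltFn.comp _)]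
    by_cases h2 : bitsToNat v < T
    · rw [if_pos (by rw [c2]; simp [h2]), if_pos h2, b2]
    · rw [if_neg (by rw [c2]; simp [h2]), if_neg h2, iteFn_of_oneBit (oneBit_eqValFn.comp _)]
      by_cases h3 : bitsToNat v = T
      · rw [if_pos (by rw [c3]; simp [h3]), if_pos h3, b3]
      · rw [if_neg (by rw [c3]; simp [h3]), if_neg h3, b1]

/-- Length of `rhoF`: at most `|w| + 2` on every input. [folklore] -/
theorem length_rhoF_le (w : List Bool) : (rhoF w).length ≤ w.length + 2 := by
  have h0 := length_fstF_sndF_le w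
  have h1 := length_fstF_sndF_le (fstF w)
  rw [rhoF, iteFn_of_oneBit (oneBit_ltFn.comp _)]
  split_ifs
  · have := length_canonN_le (sndF w); simp only [Function.comp_apply]; omega
  · rw [iteFn_of_oneBit (oneBit_ltFn.comp _)]
    split_ifs
    · have := length_succN_le (sndF w); simp only [Function.comp_apply]; omega
    · rw [iteFn_of_oneBit (oneBit_eqValFn.comp _)]
      split_ifs
      · have := length_canonN_le (fstF (fstF w)); simp only [Function.comp_apply]; omega
      · have := length_canonN_le (sndF w); simp only [Function.comp_apply]; omega

/-- Size of a relabelled index: `|bin (ρ v)| ≤ |bin v| + |bin n| + 2`. [folklore] -/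
theorem length_encodeNat_rho_le (n T v : ℕ) :
    (encodeNat (rho n T v)).length ≤ (encodeNat v).length + (encodeNat n).length + 2 := by
  unfold rho
  split_ifs
  · omega
  · have := Complexity.length_encodeNat_succ_le v; omega
  · omega
  · omega

/-! ### Op codes from numerals -/

/-- The `CZ` code on two canonical numerals. [cite: AroraBarak2009, §6.1] -/
def czCodeN (bv bw : List Bool) : List Bool :=
  false :: boolPair (encodeNat 1) (boolPair [true, true] (boolPair bv (boolPair bw [])))

/-- The `T` code on a canonical numeral. [cite: AroraBarak2009, §6.1] -/
def tCodeN (bv : List Bool) : List Bool :=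
  false :: boolPair (encodeNat 2) (boolPair [true] (boolPair bv []))

/-- The `Z` code on a canonical numeral. [cite: AroraBarak2009, §6.1] -/
def zCodeN (bv : List Bool) : List Bool :=
  false :: boolPair (encodeNat 0) (boolPair [true] (boolPair bv []))

/-- `czCodeN` on canonical numerals is the op code. [folklore] -/
theorem czCodeN_encodeNat (v w : ℕ) : czCodeN (encodeNat v) (encodeNat w) = opCode (DOp.CZ v w) := rfl

/-- `tCodeN` on a canonical numeral is the op code. [folklore] -/
theorem tCodeN_encodeNat (v : ℕ) : tCodeN (encodeNat v) = opCode (DOp.T v) := rfl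

/-- `zCodeN` on a canonical numeral is the op code. [folklore] -/
theorem zCodeN_encodeNat (v : ℕ) : zCodeN (encodeNat v) = opCode (DOp.Z v) := rfl

/-- Length of a `CZ` op code. [folklore] -/
theorem length_opCode_CZ (v w : ℕ) : (opCode (DOp.CZ v w)).length = 2 * (encodeNat v).length + 2 * (encodeNat w).length + 15 := by
  rw [← czCodeN_encodeNat]
  simp only [czCodeN, length_boolPair, List.length_cons, List.length_nil, length_encodeNat_one]
  omega

/-- Length of a `T` op code. [folklore] -/
theorem length_opCode_T (v : ℕ) : (opCode (DOp.T v)).length = 2 * (encodeNat v).length + 13 := by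
  rw [← tCodeN_encodeNat]
  simp only [tCodeN, length_boolPair, List.length_cons, List.length_nil, show (encodeNat 2).length = 2 by decide]
  omega

/-- Length of a `Z` op code. [folklore] -/
theorem length_opCode_Z (v : ℕ) : (opCode (DOp.Z v)).length = 2 * (encodeNat v).length + 9 := by
  rw [← zCodeN_encodeNat]
  simp only [zCodeN, length_boolPair, List.length_cons, List.length_nil, show (encodeNat 0).length = 0 by decide]
  omega

/-- **The `CZ` block**: on `⟨cρ, ⟨v, w⟩⟩` (`cρ = ⟨bin n, bin T⟩`), the pair-list item
`⟨opCode (CZ (ρ ⟦v⟧) (ρ ⟦w⟧)), ε⟩`. [cite: BremnerJozsaShepherdPRSA2011, Thm. 1 (proof)] -/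
def czBlockF : List Bool → List Bool := fun z =>
  boolPair (czCodeN (rhoF (boolPair (fstF z) (fstF (sndF z)))) (rhoF (boolPair (fstF z) (sndF (sndF z))))) []

/-- **The `T` block**: on `⟨cρ, v⟩`, `⟨opCode (T (ρ ⟦v⟧)), ε⟩`. [folklore] -/
def tBlockF : List Bool → List Bool := fun z => boolPair (tCodeN (rhoF z)) []

/-- **The `Z` block**: on `⟨cρ, v⟩`, `⟨opCode (Z (ρ ⟦v⟧)), ε⟩`. [folklore] -/
def zBlockF : List Bool → List Bool := fun z => boolPair (zCodeN (rhoF z)) []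

/-- A pair-valued function is in `FP` when its components are. [folklore] -/
theorem boolPair_mem_FP {f g : List Bool → List Bool} (hf : f ∈ FP) (hg : g ∈ FP) :
    (fun z => boolPair (f z) (g z)) ∈ FP := by
  have h : (fun z => boolPair (f z) (g z)) = fanoutFn f g := by funext z; simp [fanoutFn_apply]
  rw [h]; exact fanoutFn_mem_FP hf hg

/-- `czCodeN` of two `FP` functions is in `FP`. [folklore] -/
theorem czCodeN_mem_FP {f g : List Bool → List Bool} (hf : f ∈ FP) (hg : g ∈ FP) :
    (fun z => czCodeN (f z) (g z)) ∈ FP :=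
  comp_mem_FP (cons_mem_FP false) (boolPair_mem_FP (const_mem_FP _) (boolPair_mem_FP (const_mem_FP _)
    (boolPair_mem_FP hf (boolPair_mem_FP hg (const_mem_FP _)))))

/-- `czBlockF ∈ FP`. [folklore] -/
theorem czBlockF_mem_FP : czBlockF ∈ FP :=
  boolPair_mem_FP (czCodeN_mem_FP
    (comp_mem_FP rhoF_mem_FP (boolPair_mem_FP fstF_mem_FP (comp_mem_FP fstF_mem_FP sndF_mem_FP)))
    (comp_mem_FP rhoF_mem_FP (boolPair_mem_FP fstF_mem_FP (comp_mem_FP sndF_mem_FP sndF_mem_FP))))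
    (const_mem_FP _)

/-- `tBlockF ∈ FP`. [folklore] -/
theorem tBlockF_mem_FP : tBlockF ∈ FP :=
  boolPair_mem_FP (comp_mem_FP (cons_mem_FP false) (boolPair_mem_FP (const_mem_FP _)
    (boolPair_mem_FP (const_mem_FP _) (boolPair_mem_FP rhoF_mem_FP (const_mem_FP _))))) (const_mem_FP _)

/-- `zBlockF ∈ FP`. [folklore] -/
theorem zBlockF_mem_FP : zBlockF ∈ FP :=
  boolPair_mem_FP (comp_mem_FP (cons_mem_FP false) (boolPair_mem_FP (const_mem_FP _)
    (boolPair_mem_FP (const_mem_FP _) (boolPair_mem_FP rhoF_mem_FP (const_mem_FP _))))) (const_mem_FP _)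

/-- **Value of the `CZ` block.** [folklore] -/
theorem czBlockF_apply (n T : ℕ) (v w : List Bool) :
    czBlockF (boolPair (boolPair (encodeNat n) (encodeNat T)) (boolPair v w)) =
      boolPair (opCode ((DOp.CZ (bitsToNat v) (bitsToNat w)).map (rho n T))) [] := by
  simp only [czBlockF, fstF_boolPair, sndF_boolPair, rhoF_apply, czCodeN_encodeNat, DOp.map]

/-- **Value of the `T` block.** [folklore] -/
theorem tBlockF_apply (n T : ℕ) (v : List Bool) :
    tBlockF (boolPair (boolPair (encodeNat n) (encodeNat T)) v) =
      boolPair (opCode ((DOp.T (bitsToNat v)).map (rho n T))) [] := by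
  simp only [tBlockF, rhoF_apply, tCodeN_encodeNat, DOp.map]

/-- **Value of the `Z` block.** [folklore] -/
theorem zBlockF_apply (n T : ℕ) (v : List Bool) :
    zBlockF (boolPair (boolPair (encodeNat n) (encodeNat T)) v) =
      boolPair (opCode ((DOp.Z (bitsToNat v)).map (rho n T))) [] := by
  simp only [zBlockF, rhoF_apply, zCodeN_encodeNat, DOp.map]

/-- Length of the `CZ` block: linear in the argument. [folklore] -/
theorem length_czBlockF_le (z : List Bool) : (czBlockF z).length ≤ 8 * z.length + 80 := by
  have h0 := length_fstF_sndF_le z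
  have h1 := length_fstF_sndF_le (sndF z)
  have h2 := length_rhoF_le (boolPair (fstF z) (fstF (sndF z)))
  have h3 := length_rhoF_le (boolPair (fstF z) (sndF (sndF z)))
  simp only [length_boolPair] at h2 h3
  simp only [czBlockF, czCodeN, length_boolPair, List.length_cons, List.length_nil, length_encodeNat_one]
  omega

/-- Length of the `T` block. [folklore] -/
theorem length_tBlockF_le (z : List Bool) : (tBlockF z).length ≤ 4 * z.length + 40 := by
  have h2 := length_rhoF_le z
  simp only [tBlockF, tCodeN, length_boolPair, List.length_cons, List.length_nil,
    show (encodeNat 2).length = 2 by decide]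
  omega

/-- Length of the `Z` block. [folklore] -/
theorem length_zBlockF_le (z : List Bool) : (zBlockF z).length ≤ 4 * z.length + 40 := by
  have h2 := length_rhoF_le z
  simp only [zBlockF, zCodeN, length_boolPair, List.length_cons, List.length_nil,
    show (encodeNat 0).length = 0 by decide]
  omega

/-! ### The `CZ` layer loop -/

/-- The context of a layer: `⟨y, ⟨cρ, ⟨bin N, ⟨bin A, ⟨bin B, ⟨bin t, bin s⟩⟩⟩⟩⟩⟩` with a yardstick
`y`, the relabelling context `cρ = ⟨bin n, bin T⟩`, the number `N` of wires, the base `A` of the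
sources, the base `B` of the targets and the exceptional source `s` of the wire `t`. [folklore] -/
def layerCtx (y : List Bool) (n T N A B t s : ℕ) : List Bool :=
  boolPair y (boolPair (boolPair (encodeNat n) (encodeNat T)) (boolPair (encodeNat N)
    (boolPair (encodeNat A) (boolPair (encodeNat B) (boolPair (encodeNat t) (encodeNat s))))))

/-- Field `cρ` of a layer context. [folklore] -/
def lcRho (x : List Bool) : List Bool := fstF (sndF x)
/-- Field `bin N` of a layer context. [folklore] -/
def lcN (x : List Bool) : List Bool := fstF (sndF (sndF x))
/-- Field `bin A` of a layer context. [folklore] -/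
def lcA (x : List Bool) : List Bool := fstF (sndF (sndF (sndF x)))
/-- Field `bin B` of a layer context. [folklore] -/
def lcB (x : List Bool) : List Bool := fstF (sndF (sndF (sndF (sndF x))))
/-- Field `bin t` of a layer context. [folklore] -/
def lcT (x : List Bool) : List Bool := fstF (sndF (sndF (sndF (sndF (sndF x)))))
/-- Field `bin s` of a layer context. [folklore] -/
def lcS (x : List Bool) : List Bool := sndF (sndF (sndF (sndF (sndF (sndF x)))))

/-- Field of the context (`lcRho_layerCtx`). [folklore] -/
@[simp] theorem lcRho_layerCtx (y : List Bool) (n T N A B t s : ℕ) :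
    lcRho (layerCtx y n T N A B t s) = boolPair (encodeNat n) (encodeNat T) := by simp [lcRho, layerCtx]
/-- Field of the context (`lcN_layerCtx`). [folklore] -/
@[simp] theorem lcN_layerCtx (y : List Bool) (n T N A B t s : ℕ) : lcN (layerCtx y n T N A B t s) = encodeNat N := by
  simp [lcN, layerCtx]
/-- Field of the context (`lcA_layerCtx`). [folklore] -/
@[simp] theorem lcA_layerCtx (y : List Bool) (n T N A B t s : ℕ) : lcA (layerCtx y n T N A B t s) = encodeNat A := by
  simp [lcA, layerCtx]
/-- Field of the context (`lcB_layerCtx`). [folklore] -/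
@[simp] theorem lcB_layerCtx (y : List Bool) (n T N A B t s : ℕ) : lcB (layerCtx y n T N A B t s) = encodeNat B := by
  simp [lcB, layerCtx]
/-- Field of the context (`lcT_layerCtx`). [folklore] -/
@[simp] theorem lcT_layerCtx (y : List Bool) (n T N A B t s : ℕ) : lcT (layerCtx y n T N A B t s) = encodeNat t := by
  simp [lcT, layerCtx]
/-- Field of the context (`lcS_layerCtx`). [folklore] -/
@[simp] theorem lcS_layerCtx (y : List Bool) (n T N A B t s : ℕ) : lcS (layerCtx y n T N A B t s) = encodeNat s := by
  simp [lcS, layerCtx]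

/-- `lcRho ∈ FP` (composition of bricks). [folklore] -/
theorem lcRho_mem_FP : lcRho ∈ FP := comp_mem_FP fstF_mem_FP sndF_mem_FP
/-- `lcN ∈ FP` (composition of bricks). [folklore] -/
theorem lcN_mem_FP : lcN ∈ FP := comp_mem_FP fstF_mem_FP (comp_mem_FP sndF_mem_FP sndF_mem_FP)
/-- `lcA ∈ FP` (composition of bricks). [folklore] -/
theorem lcA_mem_FP : lcA ∈ FP := comp_mem_FP fstF_mem_FP (comp_mem_FP sndF_mem_FP (comp_mem_FP sndF_mem_FP sndF_mem_FP))
/-- `lcB ∈ FP` (composition of bricks). [folklore] -/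
theorem lcB_mem_FP : lcB ∈ FP :=
  comp_mem_FP fstF_mem_FP (comp_mem_FP sndF_mem_FP (comp_mem_FP sndF_mem_FP (comp_mem_FP sndF_mem_FP sndF_mem_FP)))
/-- `lcT ∈ FP` (composition of bricks). [folklore] -/
theorem lcT_mem_FP : lcT ∈ FP :=
  comp_mem_FP fstF_mem_FP (comp_mem_FP sndF_mem_FP (comp_mem_FP sndF_mem_FP (comp_mem_FP sndF_mem_FP
    (comp_mem_FP sndF_mem_FP sndF_mem_FP))))
/-- `lcS ∈ FP` (composition of bricks). [folklore] -/
theorem lcS_mem_FP : lcS ∈ FP :=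
  comp_mem_FP sndF_mem_FP (comp_mem_FP sndF_mem_FP (comp_mem_FP sndF_mem_FP (comp_mem_FP sndF_mem_FP
    (comp_mem_FP sndF_mem_FP sndF_mem_FP))))

/-- The source numeral of the wire with numeral `ba`, on `⟨x, ba⟩`: `bin s` if `⟦ba⟧ = t`, else
`bin (A + ⟦ba⟧)`. [folklore] -/
def srcF : List Bool → List Bool :=
  iteFn (eqValFn ∘ fanoutFn sndF (lcT ∘ fstF)) (canonN ∘ lcS ∘ fstF) (addFn ∘ fanoutFn (lcA ∘ fstF) sndF)

/-- `srcF ∈ FP`. [folklore] -/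
theorem srcF_mem_FP : srcF ∈ FP :=
  iteFn_mem_FP (comp_mem_FP eqValFn_mem_FP (fanoutFn_mem_FP sndF_mem_FP (comp_mem_FP lcT_mem_FP fstF_mem_FP)))
    (comp_mem_FP canonN_mem_FP (comp_mem_FP lcS_mem_FP fstF_mem_FP))
    (comp_mem_FP addFn_mem_FP (fanoutFn_mem_FP (comp_mem_FP lcA_mem_FP fstF_mem_FP) sndF_mem_FP))

/-- Value of `srcF` on a layer context. [folklore] -/
theorem srcF_apply (y : List Bool) (n T N A B t s a : ℕ) :
    srcF (boolPair (layerCtx y n T N A B t s) (encodeNat a)) = encodeNat (if a = t then s else A + a) := by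
  set z := boolPair (layerCtx y n T N A B t s) (encodeNat a) with hz
  have c1 : (eqValFn ∘ fanoutFn sndF (lcT ∘ fstF)) z = [decide (a = t)] := by
    simp only [hz, Function.comp_apply, fanoutFn_apply, sndF_boolPair, fstF_boolPair, lcT_layerCtx,
      eqValFn_boolPair, bitsToNat_encodeNat]
  have b1 : (canonN ∘ lcS ∘ fstF) z = encodeNat s := by
    simp only [hz, Function.comp_apply, fstF_boolPair, lcS_layerCtx, canonN_apply, bitsToNat_encodeNat]
  have b2 : (addFn ∘ fanoutFn (lcA ∘ fstF) sndF) z = encodeNat (A + a) := by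
    simp only [hz, Function.comp_apply, fanoutFn_apply, fstF_boolPair, sndF_boolPair, lcA_layerCtx, addFn_boolPair,
      bitsToNat_encodeNat]
  rw [srcF, iteFn_of_oneBit (oneBit_eqValFn.comp _)]
  by_cases h : a = t
  · rw [if_pos (by rw [c1]; simp [h]), if_pos h, b1]
  · rw [if_neg (by rw [c1]; simp [h]), if_neg h, b2]

/-- The layer piece at index `1ᵃ`: on `⟨x, 1ᵃ⟩`, the `CZ` block of `(src a, B + a)`. [folklore] -/
def layerPiece : List Bool → List Bool :=
  czBlockF ∘ fanoutFn (lcRho ∘ fstF) (fanoutFn (srcF ∘ fanoutFn fstF (lenBinF ∘ sndF))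
    (addFn ∘ fanoutFn (lcB ∘ fstF) (lenBinF ∘ sndF)))

/-- `layerPiece ∈ FP`. [folklore] -/
theorem layerPiece_mem_FP : layerPiece ∈ FP :=
  comp_mem_FP czBlockF_mem_FP (fanoutFn_mem_FP (comp_mem_FP lcRho_mem_FP fstF_mem_FP)
    (fanoutFn_mem_FP (comp_mem_FP srcF_mem_FP (fanoutFn_mem_FP fstF_mem_FP (comp_mem_FP lenBinF_mem_FP sndF_mem_FP)))
      (comp_mem_FP addFn_mem_FP (fanoutFn_mem_FP (comp_mem_FP lcB_mem_FP fstF_mem_FP)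
        (comp_mem_FP lenBinF_mem_FP sndF_mem_FP)))))

/-- **Value of the layer piece.** [folklore] -/
theorem layerPiece_apply (y : List Bool) (n T N A B t s a : ℕ) :
    layerPiece (boolPair (layerCtx y n T N A B t s) (ones a)) =
      boolPair (opCode ((DOp.CZ (if a = t then s else A + a) (B + a)).map (rho n T))) [] := by
  simp only [layerPiece, Function.comp_apply, fanoutFn_apply, fstF_boolPair, sndF_boolPair, lenBinF_apply,
    List.length_replicate, srcF_apply, lcRho_layerCtx, lcB_layerCtx, addFn_boolPair, bitsToNat_encodeNat,
    czBlockF_apply]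

/-- Length of the actual pieces of a layer: linear in the context. [folklore] -/
theorem length_layerPiece_ctx_le (y : List Bool) (n T N A B t s a : ℕ) (ha : a ≤ y.length) :
    (layerPiece (boolPair (layerCtx y n T N A B t s) (ones a))).length ≤
      120 * ((layerCtx y n T N A B t s).length + 1) := by
  rw [layerPiece_apply]
  have e1 := length_encodeNat_rho_le n T (if a = t then s else A + a)
  have e2 := length_encodeNat_rho_le n T (B + a)
  have e3 : (encodeNat (if a = t then s else A + a)).length ≤ (encodeNat s).length + (encodeNat A).length + a + 1 := by
    split_ifs
    · omega
    · have := length_encodeNat_add_le' A a; have := length_encodeNat_le_self a; omega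
  have e4 : (encodeNat (B + a)).length ≤ (encodeNat B).length + a + 1 := by
    have := length_encodeNat_add_le' B a; have := length_encodeNat_le_self a; omega
  simp only [DOp.map, length_boolPair, length_opCode_CZ, List.length_nil, layerCtx]
  omega

/-- **The `CZ` layer**: `N` rounds of the fold loop with `appF` over the clipped layer piece, from
the record `⟨x, ⟨bin N, ⟨1⁰, ε⟩⟩⟩`, then the accumulator. [cite: AroraBarak2009, §1.3 (bounded loops)] -/
def layerF : List Bool → List Bool :=
  sndF ∘ sndF ∘ sndF ∘ foldLoop appF (clipF 120 layerPiece) X ∘ fanoutFn id (fanoutFn lcN fun _ => boolPair (ones 0) [])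

/-- `layerF ∈ FP`. [cite: AroraBarak2009, §1.3, §1.4.1] -/
theorem layerF_mem_FP : layerF ∈ FP :=
  comp_mem_FP sndF_mem_FP (comp_mem_FP sndF_mem_FP (comp_mem_FP sndF_mem_FP (comp_mem_FP
    (foldLoop_clipF_mem_FP 120 appF_mem_FP length_appF_le layerPiece_mem_FP X)
    (fanoutFn_mem_FP (PolyTimeComputable.id _) (fanoutFn_mem_FP lcN_mem_FP (const_mem_FP _))))))

/-- **Value of the `CZ` layer** on a context whose yardstick has length `≥ N`:
`encList [opCode (CZ (ρ (src a)) (ρ (B + a))) | a < N]`. [cite: BremnerJozsaShepherdPRSA2011, Thm. 1 (proof)] -/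
theorem layerF_apply (y : List Bool) (n T N A B t s : ℕ) (hy : N ≤ y.length) :
    layerF (layerCtx y n T N A B t s) = encList (List.ofFn fun a : Fin N =>
      opCode ((DOp.CZ (if (a : ℕ) = t then s else A + a) (B + a)).map (rho n T))) := by
  have hlen : N ≤ X.eval (layerCtx y n T N A B t s).length := by
    rw [eval_X]; simp only [layerCtx, length_boolPair]; omega
  simp only [layerF, Function.comp_apply, fanoutFn_apply, id, lcN_layerCtx]
  rw [foldLoop_apply _ _ hlen 0 [], sndF_boolPair, sndF_boolPair, sndF_boolPair,
    foldAcc_clipF (fun j _ hj => ?_), foldAcc_appF, List.nil_append,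
    encList_ofFn_eq_ccat _ (fun j => opCode ((DOp.CZ (if j = t then s else A + j) (B + j)).map (rho n T)))
      (fun a => rfl)]
  · congr 1
    funext j
    rw [zero_add, layerPiece_apply]
  · exact length_layerPiece_ctx_le y n T N A B t s j (by omega)

/-- **Length of the `CZ` layer on every input** (the loop runs `|x|` rounds of a body growing
linearly in `|x|`): quadratic in `|x|`. [folklore] -/
theorem length_layerF_le (x : List Bool) : (layerF x).length ≤ 3 * x.length + 6 + x.length * (128 * (x.length + 1)) := by
  have hbody := length_foldBody_le (op := appF) (f := clipF 120 layerPiece) length_appF_le (length_clipF_le 120 layerPiece)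
  set z0 := boolPair x (boolPair (lcN x) (boolPair (ones 0) [])) with hz0
  have hfst : fstF z0 = x := by simp [hz0]
  have hz : z0.length ≤ 3 * x.length + 6 := by
    have := length_fstF_sndF_le (sndF (sndF x))
    have := length_fstF_sndF_le (sndF x)
    have := length_fstF_sndF_le x
    simp only [hz0, length_boolPair, lcN, List.length_nil, List.length_replicate]
    omega
  have hit := length_iterate_le_of_growth (F := loopStep (foldBody appF (clipF 120 layerPiece))) (120 + 0 + 4 + 4)
    (fun w => fstF_loopStep _ w) (fun w => length_loopStep_le hbody w) z0 x.length
  have hx : (boolUnpair z0).1 = x := by simp [hz0]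
  rw [hx] at hit
  have h3 : ∀ w : List Bool, (sndF (sndF (sndF w))).length ≤ w.length := fun w => by
    have := length_fstF_sndF_le w; have := length_fstF_sndF_le (sndF w); have := length_fstF_sndF_le (sndF (sndF w))
    omega
  have hval : layerF x = sndF (sndF (sndF ((loopStep (foldBody appF (clipF 120 layerPiece)))^[x.length] z0))) := by
    simp only [layerF, Function.comp_apply, fanoutFn_apply, id, foldLoop, hfst, eval_X, ← hz0]
  rw [hval]
  refine (h3 _).trans (hit.trans ?_)
  have : x.length * ((120 + 0 + 4 + 4) * (x.length + 1)) = x.length * (128 * (x.length + 1)) := by norm_num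
  omega

end HGadget

end Literature.Computability.QuantumComplexity
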